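import Literature.MathematicalPhysics.QuantumFieldTheory.BalabanImbrieJaffe1984to88.BIJ88Sect5StatementsPart3
import Literature.MathematicalPhysics.QuantumFieldTheory.BalabanImbrieJaffe1984to88.BIJ88Sect5StatementsPart2

/-!
# `BalabanImbrieJaffe1984to88.BIJ88Sect5StatementsPart4` — T. Bałaban, J. Imbrie, A. Jaffe, *Effective action and cluster
properties of the abelian Higgs model*, Commun. Math. Phys. **114** (1988) 257–315 [BalabanImbrieJaffe1988]: Sect. 5, part 4 —
the FINITE ALGEBRA of Sects. 5.6–5.14: the expansions (5.6.8), (5.6.9), (5.6.10), (5.6.12); the normalization-factor identities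
(5.7.2)–(5.7.3); the localization (5.7.5); the resummation telescoping behind (5.7.10) (pp. 291–292); the scalar translation
(5.8.1) and the identity of [7] (p. 296); the restrictions (5.9.1)–(5.9.2) and the characteristic functions `χ_{k+1,Λ₀^{(k)′}}`, `χ′_{Λ₇^{(k)}}`
of p. 297; the observable and characteristic-function expansions of p. 300; the quadratic form (5.13.2); the perturbative terms
and the remainder (5.14.2) with Taylor's formula.  (The cross-file dictionary `λ_k`/`P_k`/`E^{(k)}` of ref-2 I2 lives in
`BIJ88Sect5Statements` v1.3: `lamK_eq_Sect2`, `Pk_eq_Sect4`, `E0step_eq_card_mul_normE`.)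

statement-level skeleton of published theorems with citation tags; proofs where landed; nothing here is a claim about the Yang–Mills mass gap

PDF held: `paper:balaban1988-cmp114-bij-abelian-higgs-effective-action` (journal page = PDF page + 256; OFFLOADED store file,
`lit pull papers/<key>/original.pdf`).  Renders read as images: PDF pp. 31–33, 35–36, 40–41, 44–45, 48, 52 (journal 287–289,
291–292, 296–297, 300–301, 304, 308), `g4png.py` ×2 (r16 seat folder `scratch/c2pages/`).

CITATION HEADER (lean-in-tree rule).  Part of the lit-balaban TYPED SKELETON (HOME `run/shared/lean/pub/lit-balaban/`; rows
`C2.Eq5.6.6-5.6.12`, `C2.Eq5.7.1-5.7.4`, `C2.Eq5.7.5-5.7.6`, `C2.Eq5.7.10-5.7.12`, `C2.Eq5.8.1-5.8.3`, `C2.Eq5.9.1-5.9.2`, `C2.Eq5.9.3`,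
`C2.Eq5.9.4-5.9.5`, `C2.Txt@300`, `C2.Eq5.12.1-5.12.7`, `C2.Eq5.13.1-5.13.2`, `C2.Eq5.14.1-5.14.2`, `C2.Claim@312` of `HOME/lit-balaban-r16/ROWS-C2-part2.md`; companion of
`BIJ88Sect5Statements`, `…Part2`, `…Part3`; unit `lit-balaban-r16`, reader of C2 Sect. 5).  WHAT IS REPRODUCED, and how.
(a) DEFINITIONS WITH BODIES: the covariant weighted block average and its first-order part `F_{2,l}` (5.6.8) (over an abstract
block/contour datum, as `BIJ85CellAverages`), `V_j(Ω)` (5.6.10) and `W^{(j)}` (5.7.2) DEFINED as the printed differences, the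
localized powers `w_{b,m}(X)` (5.7.5) (association map abstract), the translation (5.8.1), the characteristic functions of p. 297 on
the carriers of `BIJ88Sect3Statements`/`BIJ88Sect5Statements`, the regions `Λ̃₈^{(k)}`, `Λ₉^{(k)}`, `Λ̃₉^{(k)}` (= the p. 279 construction
`BIJ88Sect5StatementsPart3.smallFieldRegion` re-applied), `Λ₁₀^{(k)}` of p. 300 (collar deletion over a distance datum), the quadratic form (5.13.2) in a ring of operators, the perturbative
terms `𝒫̃_{k+1}` and the remainder `ℛ_k` of (5.14.2) (the truncated expectation as a function of `t`).  (b) PROVED: (5.6.8), (5.6.9)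
(pointwise algebra of `e^{w} = 1 + F₁(w)`), (5.6.10) by definition, the iterated resolvent expansion (5.6.12) from (5.6.11)
(`BIJ88Sect5Statements.eq5611`), the factorization `C^{−1} − W = C^{−1/2}(I − C^{1/2}WC^{1/2})C^{−1/2}` and the determinant identity
behind (5.7.3), the localization identity (5.7.5) (multinomial expansion + fibrewise regrouping), the telescoping identity
`θ_k + Σ_{j=−1}^{k−1} θ_j(1 − θ_{j+1}) = 1` under the nesting `θ_jθ_{j+1} = θ_{j+1}` (p. 292, `θ_{−1} = 1`) and hence the splitting
`Ã̃ = θ_k(H_{k,loc}A^{(k)} + w₅A′) + Σ_j θ_j(1 − θ_{j+1})w₅A′` of p. 291, the expansions of p. 300 (finite products), the completing-the-square identity behind the conditioning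
formula of p. 300 (`completeSquare300`; block matrices, the Gaussian integrals themselves not typed), Taylor's formula with
integral remainder for `log z_t` (Mathlib `taylor_integral_remainder`) — which matches (5.14.2) iff the printed truncated
expectation `⟨d/dt;…;d/dt⟩_t` equals `(n̄+1)·d^{n̄+1}/dt^{n̄+1} log z_t` (TRANSCRIPTION NOTE at `remR`, not adjudicated).  (c) STATEMENTS as
`def … : Prop`: (5.9.1) (= `BIJ88Sect5StatementsPart3.SmallF`), (5.9.2), the identity of [7] p. 296, the `|G_k(X)|` estimate of p. 312 (leaf over
`BIJ88Sect5StatementsPart2.PolymerSys`).  NOT typed: (5.7.4) (trace–log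
expansion), (5.7.7)–(5.7.8), (5.7.11)–(5.7.15), (5.8.2)–(5.8.3), (5.9.6), the integral form of the conditioning identity of p. 300 and (5.12.1)–(5.12.8),
(5.13.1), (5.13.3)–(5.13.4), (5.14.1), (5.14.3)–(5.15.4) (bookkeeping over the regions/Gaussian integrals; rows keep their Part-2
bound leaves).  NOTHING of the paper is asserted beyond the kernel-checked items under (b).  Unit `lit-balaban-r16` (gen 2).
-/

namespace Literature.MathematicalPhysics.QuantumFieldTheory.BalabanImbrieJaffe1984to88.BIJ88Sect5StatementsPart4

open Literature.MathematicalPhysics.QuantumFieldTheory.Balaban1983to89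
open BIJ88Sect3Statements BIJ88Sect4Statements BIJ88Sect5Statements BIJ88Sect5StatementsPart3
open scoped BigOperators
open Complex

noncomputable section

/-! ## (5.6.8)–(5.6.12): expansions with respect to the fluctuation field -/

/-- **(5.6.8)** p. 287 [PDF 31], the covariant block average, verbatim: *"(Q_l(ũ_{k+1}ũ)φ)(y) = Σ_{x∈B_l(y)} L^{−ld}ũ_{k+1}(Γ^{(l)}_{y,x})φ(x)
(1 + Σ_{n=1}^∞ (ie_jζA(Γ^{(l)}_{y,x}))ⁿ/n!)"* — the generic form `(Q(U)φ)(y) = Σ_{x∈B(y)} w·U(y,x)φ(x)` over an abstract block datum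
`B` (the blocks `B_l(y)`), weight `w = L^{−ld}` and transporters `U(y,x) = ũ(Γ_{y,x})`. [cite: BalabanImbrieJaffe1988, (5.6.8) p.287] -/
def covAvg {α β : Type*} (B : β → Finset α) (w : ℝ) (U : β → α → ℂ) (φ : α → ℂ) (y : β) : ℂ :=
  ∑ x ∈ B y, (w : ℂ) * U y x * φ x

/-- **(5.6.8)**, the first-order part `(F_{2,l}(Ã, ũ_{k+1})φ)(y) := Σ_{x∈B_l(y)} L^{−ld}ũ_{k+1}(Γ_{y,x})φ(x)F₁(ie_jζÃ(Γ_{y,x}))`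
(`F₁(w) = e^{w} − 1`, `BIJ88Sect5Statements.F1`; `a y x` = the exponent `ie_jζÃ(Γ^{(l)}_{y,x})`). [cite: BalabanImbrieJaffe1988, (5.6.8) p.287] -/
def F2 {α β : Type*} (B : β → Finset α) (w : ℝ) (U : β → α → ℂ) (a : β → α → ℂ) (φ : α → ℂ) (y : β) : ℂ :=
  ∑ x ∈ B y, (w : ℂ) * U y x * φ x * F1 (a y x)

/-- **(5.6.8)** p. 287 [PDF 31], verbatim: *"… = (Q_l(ũ_{k+1})φ)(y) + (F_{2,l}(Ã, ũ_{k+1})φ)(y). (5.6.8)"* — PROVED: the average with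
transporters `ũ(Γ)e^{a(Γ)}` splits as printed. [cite: BalabanImbrieJaffe1988, (5.6.8) p.287] -/
theorem eq568 {α β : Type*} (B : β → Finset α) (w : ℝ) (U a : β → α → ℂ) (φ : α → ℂ) (y : β) :
    covAvg B w (fun y x => U y x * exp (a y x)) φ y = covAvg B w U φ y + F2 B w U a φ y := by
  simp only [covAvg, F2, F1, ← Finset.sum_add_distrib]
  exact Finset.sum_congr rfl fun x _ => by ring

variable {P : Params} {j : ℕ}

/-- **(5.6.9)** p. 287 [PDF 31], verbatim: *"For the covariant derivative on the ζ-lattice, we have (𝒟_{ũ_{k+1}ũ}φ)(b) = (D_{ũ_{k+1}}φ)(b)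
+ ũ_{k+1,b}F_{1,j}(Ã)φ(b₊). (5.6.9)"* — PROVED for `BIJ88Sect3Statements.covD c` (the overall lattice factor `c` on both terms).
[cite: BalabanImbrieJaffe1988, (5.6.9) p.287] -/
theorem eq569 (c : ℝ) (u : PBond P j → ℂ) (a : PBond P j → ℂ) (φ : Balaban1983to89.Site P j → ℂ) (b : PBond P j) :
    covD c (fun b => u b * exp (a b)) φ b = covD c u φ b + (c : ℂ) * u b * F1 (a b) * φ b.tgt := by
  simp only [covD, F1]
  ring

section Ring

variable {R : Type*} [Ring R]

/-- **(5.6.10)** p. 287 [PDF 31], verbatim: *"For the basic quadratic form with Neumann boundary conditions on Ω giving rise to G_j(Ω),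
we have −Δ^N_{ũ_{k+1}ũ,Ω} + a_jP_j(ũ_{k+1}ũ) = −Δ^N_{ũ_{k+1},Ω} + a_jP_j(ũ_{k+1}) − V_j(Ω), (5.6.10) where V_j(Ω) is obtained by inserting
(5.6.8), (5.6.9) into the left-hand side."* — `V_j(Ω)` DEFINED as the difference of the two operators (`ΔNu, Pu` at `ũ_{k+1}`,
`ΔNuu, Puu` at `ũ_{k+1}ũ`). [cite: BalabanImbrieJaffe1988, (5.6.10) p.287] -/
def Vj (aj ΔNu Pu ΔNuu Puu : R) : R := (-ΔNu + aj * Pu) - (-ΔNuu + aj * Puu)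

/-- kernel: (5.6.10) holds with `V_j(Ω)` so defined. [cite: BalabanImbrieJaffe1988, (5.6.10) p.287] -/
theorem eq5610 (aj ΔNu Pu ΔNuu Puu : R) : -ΔNuu + aj * Puu = -ΔNu + aj * Pu - Vj aj ΔNu Pu ΔNuu Puu := by
  rw [Vj]; abel

/-- **(5.6.12)** p. 288 [PDF 32], verbatim: *"This is now iterated to yield G_{j,loc}(ũ_{k+1}ũ) = Σ_{n=0}^{n̄} G_{j,loc}(ũ_{k+1})
[V_jG_{j,loc}(ũ_{k+1})]ⁿ + G_{j,loc}(ũ_{k+1})[V_jG_{j,loc}(ũ_{k+1})]^{n̄}V_jG_{j,loc}(ũ_{k+1}ũ) + w₆, (5.6.12) with another small kernel w₆."* —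
the iteration of the resolvent identity (5.6.11) (`BIJ88Sect5Statements.eq5611`: `g₀a = 1`, `(a − v)g = 1 ⟹ g = g₀ + g₀vg`), PROVED
to every order `N` WITHOUT the kernel `w₆` (which collects the difference between `G_j(Ω, ·)` and `G_{j,loc}`, p. 287).
[cite: BalabanImbrieJaffe1988, (5.6.12) p.288] -/
theorem eq5612 {a v g₀ g : R} (h₀ : g₀ * a = 1) (h : (a - v) * g = 1) (N : ℕ) :
    g = (∑ n ∈ Finset.range (N + 1), g₀ * (v * g₀) ^ n) + g₀ * (v * g₀) ^ N * v * g := by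
  induction N with
  | zero => simpa using eq5611 h₀ h
  | succ N ih =>
    have e := eq5611 h₀ h
    have key : g₀ * (v * g₀) ^ N * v * g = g₀ * (v * g₀) ^ (N + 1) + g₀ * (v * g₀) ^ (N + 1) * v * g := by
      conv_lhs => rw [e]
      rw [pow_succ]
      noncomm_ring
    rw [Finset.sum_range_succ, add_assoc, ← key]
    exact ih

/-! ## (5.7.2)–(5.7.3): the normalization factors -/

/-- **(5.7.2)** p. 289 [PDF 33], verbatim: *"C^{(j)}_{Λ₁₀^{(j)}}(u_{k+1}ũ̃)^{−1} = Δ_{j,loc}(u_{k+1}ũ̃) + aL^{−2}P(u_{k+1}ũ̃) = Δ_{j,loc}(u_{k+1}) +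
aL^{−2}P(u_{k+1}) − W^{(j)} = C^{(j)}_{Λ₁₀^{(j)}}(u_{k+1})^{−1} − W^{(j)}. (5.7.2) All the terms from our expansions of the last section for Δ_{j,loc},
P, with ũ_{k+1} replaced with u_{k+1}, ũ replaced with ũ̃, are included in W^{(j)}."* — `W^{(j)}` DEFINED as the difference (`aL2` = the
scalar `aL^{−2}` as a ring element). [cite: BalabanImbrieJaffe1988, (5.7.2) p.289] -/
def Wj (aL2 Δu Pu Δuu Puu : R) : R := (Δu + aL2 * Pu) - (Δuu + aL2 * Puu)

/-- kernel: (5.7.2) holds with `W^{(j)}` so defined. [cite: BalabanImbrieJaffe1988, (5.7.2) p.289] -/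
theorem eq572 (aL2 Δu Pu Δuu Puu : R) : Δuu + aL2 * Puu = Δu + aL2 * Pu - Wj aL2 Δu Pu Δuu Puu := by
  rw [Wj]; abel

/-- p. 289 [PDF 33], the display after (5.7.2), verbatim: *"Thus we have C^{(j)}(u_{k+1}ũ̃)^{−1} = C^{(j)}(u_{k+1})^{−1/2}(I −
C^{(j)}(u_{k+1})^{1/2}W^{(j)}C^{(j)}(u_{k+1})^{1/2})C^{(j)}(u_{k+1})^{−1/2}"* — PROVED in any ring for a square root `S = C^{1/2}` with two-sided
inverse `Sinv = C^{−1/2}`, `C^{−1} = Sinv²`. [cite: BalabanImbrieJaffe1988, (5.7.3) p.289] -/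
theorem eq573_factor {Cinv S Sinv W : R} (h1 : S * Sinv = 1) (h2 : Sinv * S = 1) (hC : Sinv * Sinv = Cinv) :
    Cinv - W = Sinv * (1 - S * W * S) * Sinv := by
  calc Cinv - W = Sinv * Sinv - (Sinv * S) * W * (S * Sinv) := by rw [hC, h2, h1, one_mul, mul_one]
    _ = Sinv * (1 - S * W * S) * Sinv := by noncomm_ring

end Ring

/-- **(5.7.3)** p. 289 [PDF 33], verbatim: *"and so Z^{(j)}(u_k) = Z^{(j)}(u_{k+1})[det(I − C^{(j)}(u_{k+1})^{1/2}W^{(j)}C^{(j)}(u_{k+1})^{1/2})]^{−1/2}.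
(5.7.3)"* — the determinant identity behind it (Gaussian normalization factors are `det(C^{−1})^{−1/2}` up to constants), PROVED for
matrices: `det(C^{−1} − W) = det(C^{−1})·det(I − C^{1/2}WC^{1/2})`. [cite: BalabanImbrieJaffe1988, (5.7.3) p.289] -/
theorem det_eq573 {n : Type*} [Fintype n] [DecidableEq n] {K : Type*} [CommRing K] {Cinv S Sinv W : Matrix n n K}
    (h1 : S * Sinv = 1) (h2 : Sinv * S = 1) (hC : Sinv * Sinv = Cinv) :
    (Cinv - W).det = Cinv.det * (1 - S * W * S).det := by
  rw [eq573_factor h1 h2 hC, Matrix.det_mul, Matrix.det_mul, ← hC, Matrix.det_mul]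
  ring

/-! ## (5.7.5): localization of the powers of the nonlocal kernel `w₅` -/

/-- kernel, the expansion behind **(5.7.5)** p. 289: `((w₅A′)_b)^m = (Σ_{b′} w₅(b,b′)A′(b′))^m = Σ_{(b₁,…,b_m)} Π_l w₅(b,b_l)A′(b_l)`
(multinomial expansion over ordered m-tuples of bonds). [cite: BalabanImbrieJaffe1988, (5.7.5) p.289] -/
theorem pow_applyKernel_eq_sum_tuples {β : Type*} [Fintype β] [DecidableEq β] (w : β → β → ℝ) (A' : β → ℝ) (b : β) (m : ℕ) :
    (∑ b', w b b' * A' b') ^ m = ∑ t : Fin m → β, ∏ l, w b (t l) * A' (t l) := by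
  rw [← Fintype.prod_sum fun (_ : Fin m) (b' : β) => w b b' * A' b']
  simp

/-- **(5.7.5)** p. 289 [PDF 33], verbatim: *"To each b ∈ T_η and each collection of bonds b₁, …, b_m ∈ T^{(k)} we associate in some
arbitrary manner a set X (a connected union of r(e_k)-cubes containing them). Then we put (w₅A′)^m_b = Σ_X w_{b,m}(X), (5.7.5)
w_{b,m}(X) = Σ_{(b₁…b_m) compatible with b,X} Π_{l=1}^m (w₅(b,b_l)A′(b_l)), where compatible means that b₁, …, b_m, b were associated
to X as above."* — `assoc` = the (arbitrary) association map at fixed `b`, polymers of type `ξ`.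
[cite: BalabanImbrieJaffe1988, (5.7.5) p.289] -/
def wbm {β ξ : Type*} [Fintype β] [DecidableEq ξ] (w : β → β → ℝ) (A' : β → ℝ) (b : β) (m : ℕ)
    (assoc : (Fin m → β) → ξ) (X : ξ) : ℝ :=
  ∑ t ∈ (Finset.univ : Finset (Fin m → β)).filter (fun t => assoc t = X), ∏ l, w b (t l) * A' (t l)

/-- **(5.7.5)** PROVED: `((w₅A′)_b)^m = Σ_X w_{b,m}(X)` (fibrewise regrouping of the tuple expansion over the association map).
[cite: BalabanImbrieJaffe1988, (5.7.5) p.289] -/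
theorem eq575 {β ξ : Type*} [Fintype β] [DecidableEq β] [Fintype ξ] [DecidableEq ξ] (w : β → β → ℝ) (A' : β → ℝ) (b : β)
    (m : ℕ) (assoc : (Fin m → β) → ξ) :
    (∑ b', w b b' * A' b') ^ m = ∑ X : ξ, wbm w A' b m assoc X := by
  rw [pow_applyKernel_eq_sum_tuples]
  unfold wbm
  exact (Finset.sum_fiberwise_of_maps_to (fun _ _ => Finset.mem_univ _) _).symm

/-! ## pp. 291–292: the resummation of `Ã̃` over scales (the telescoping behind (5.7.10)) -/

/-- kernel, p. 291 last display / p. 292 first line, verbatim: *"Thus we write Ã̃ = θ_k(H_{k,loc}A^{(k)} + w₅A′) + Σ_{j=−1}^{k−1}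
θ_j(1 − θ_{j+1})w₅A′ = Ã̃_k + Σ_{j=0}^{k−1} Ã̃_j. Here θ_{−1} = 1, and each Ã̃_j is a smooth, small field supported in Λ̄₅^{(j)} ∩ Λ̄₆^{(j+1)c}"* —
the telescoping identity that reconciles this with (5.7.1) `Ã̃ = θ_kH_{k,loc}A^{(k)} + w₅A′`: with the shifted indexing `ϑ_i = θ_{i−1}`
(`ϑ_0 = θ_{−1} = 1`) and the NESTING `ϑ_iϑ_{i+1} = ϑ_{i+1}` (each `θ_{j+1}` is supported where `θ_j = 1`, by `Λ₅^{(j+1)} ⊂ Λ₀^{(j+1)} ⊂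
Λ₁₃^{(j)} ⊂ Λ₆^{(j)}`, p. 274), `ϑ_{k+1} + Σ_{i=0}^{k} ϑ_i(1 − ϑ_{i+1}) = 1`, PROVED pointwise in any commutative ring.
[cite: BalabanImbrieJaffe1988, (5.7.10) p.291] -/
theorem telescope5710 {S : Type*} [CommRing S] (ϑ : ℕ → S) (h0 : ϑ 0 = 1) (hnest : ∀ i, ϑ i * ϑ (i + 1) = ϑ (i + 1))
    (k : ℕ) : ϑ (k + 1) + ∑ i ∈ Finset.range (k + 1), ϑ i * (1 - ϑ (i + 1)) = 1 := by
  induction k with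
  | zero => simp [h0]
  | succ k ih =>
    rw [Finset.sum_range_succ]
    linear_combination ih - hnest (k + 1)

/-- p. 291, PROVED: with the nesting, `θ_k(HA + w₅A′) + Σ_{j=−1}^{k−1} θ_j(1 − θ_{j+1})·w₅A′ = θ_kHA + w₅A′` pointwise (values in a
commutative ring; `ϑ_i = θ_{i−1}`, `ϑ_{k+1} = θ_k`). [cite: BalabanImbrieJaffe1988, (5.7.10) p.291] -/
theorem eq5710_split {S : Type*} [CommRing S] (ϑ : ℕ → S) (h0 : ϑ 0 = 1) (hnest : ∀ i, ϑ i * ϑ (i + 1) = ϑ (i + 1))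
    (k : ℕ) (HA w5A : S) :
    ϑ (k + 1) * (HA + w5A) + ∑ i ∈ Finset.range (k + 1), ϑ i * (1 - ϑ (i + 1)) * w5A = ϑ (k + 1) * HA + w5A := by
  have h := telescope5710 ϑ h0 hnest k
  rw [← Finset.sum_mul]
  linear_combination w5A * h

/-! ## (5.8.1) and the identity of [7] (p. 296): the scalar field translation -/

section Scalar

variable {M N : Type*} [AddCommGroup M] [Module ℝ M] [AddCommGroup N] [Module ℝ N]

/-- **(5.8.1)** p. 295 [PDF 39], verbatim (row C2.Eq5.8.1-5.8.3): *"φ = φ^{(k)} + aL^{−2}Λ₇^{(k)}C^{(k)}_{loc}(u_{k+1})Q^*(u_{k+1})ψ (5.8.1)"*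
— over real vector spaces of unit-lattice (`M`) and block-lattice (`N`) scalar fields, the operators as linear maps (`Λ7` = the
restriction to `Λ₇^{(k)}`). [cite: BalabanImbrieJaffe1988, (5.8.1) p.295] -/
def transl581 (a L : ℝ) (Λ7 Cloc : Module.End ℝ M) (Qst : N →ₗ[ℝ] M) (φk : M) (ψ : N) : M :=
  φk + (a * L⁻¹ ^ 2) • Λ7 (Cloc (Qst ψ))

/-- kernel: the translation (5.8.1) is affine in `φ^{(k)}` with unit slope — `φ − φ^{(k)}` is the printed shift.
[cite: BalabanImbrieJaffe1988, (5.8.1) p.295] -/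
theorem transl581_sub (a L : ℝ) (Λ7 Cloc : Module.End ℝ M) (Qst : N →ₗ[ℝ] M) (φk : M) (ψ : N) :
    transl581 a L Λ7 Cloc Qst φk ψ - φk = (a * L⁻¹ ^ 2) • Λ7 (Cloc (Qst ψ)) := by
  simp [transl581]

end Scalar

/-- p. 296 [PDF 40], verbatim: *"We apply the identity [7] aL^{−2}I − a²L^{−4}Q(u_{k+1})C^{(k)}(u_{k+1})Q(u_{k+1})^* = a_kL^{−2}I −
a_k²L^{−4}Q_{k+1}(u_{k+1})G^η_{k+1}(u_{k+1})Q_{k+1}(u_{k+1})^*, but in a localized version with C^{(k)}_{loc} and G^η_{k+1,loc} and with another small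
kernel w″₇ on the right."* ([7] = Bałaban, (Higgs)₂,₃ I — a DEPGRAPH edge) — the identity as a statement in an ℝ-algebra of operators
on the block-lattice scalar fields (`Q, C, Qst` resp. `Q1, G, Q1st` the printed factors). [cite: BalabanImbrieJaffe1988, (5.8.3) p.296] -/
def IdentityB1p296 {R : Type*} [Ring R] [Algebra ℝ R] (a ak L : ℝ) (Q C Qst Q1 G Q1st : R) : Prop :=
  algebraMap ℝ R (a * L⁻¹ ^ 2) - algebraMap ℝ R (a ^ 2 * L⁻¹ ^ 4) * (Q * C * Qst)
    = algebraMap ℝ R (ak * L⁻¹ ^ 2) - algebraMap ℝ R (ak ^ 2 * L⁻¹ ^ 4) * (Q1 * G * Q1st)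

/-! ## (5.9.1)–(5.9.2) and p. 297: bounds on fluctuation and block fields, the inserted characteristic functions -/

/-- **(5.9.1)** p. 296 [PDF 40], verbatim: *"As we remarked earlier, the restrictions on u(p) and the gauge field renormalization
transformations imply that |(1/ie_k) log v(p)| = |f(p)| ≦ cp(e_k), p ∈ Λ₀^{(k)′**}. (5.9.1)"* — this is the predicate
`BIJ88Sect5StatementsPart3.SmallF` of p. 280 (the block-lattice region `Λ₀^{(k)′}` by its sites). [cite: BalabanImbrieJaffe1988, (5.9.1) p.296] -/
theorem restr591_iff (c pek ek : ℝ) (Λ0' : Finset (Balaban1983to89.Site P j)) (v : Plaq P j → ℂ) :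
    SmallF c pek ek Λ0' v ↔ ∀ p ∈ starP Λ0', ‖fieldStrength ek (v p)‖ ≤ c * pek := Iff.rfl

/-- **(5.9.2)** p. 296 [PDF 40], verbatim: *"Also, bounds on φ and ψ − Q(u_k)φ imply that for y ∈ Λ₀^{(k)′}, |ψ(y)| ≦ cp(e_k)λ_k^{−1/4},
(L^kε)^d < λ, ||ψ(y)| − (8λ)^{−1/2}(L^kε)^{(d−2)/2}| ≦ cp(e_k)(L^kε)^{−1}, (L^kε)^d ≧ λ. (5.9.2)"* — on the block-lattice sites of the region,
`s = L^kε`, `lamk = λ_k`. [cite: BalabanImbrieJaffe1988, (5.9.2) p.296] -/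
def Restr592 (c pek lamk lam s : ℝ) (d : ℕ) (Λ0' : Finset (Balaban1983to89.Site P j)) (ψ : Balaban1983to89.Site P j → ℂ) :
    Prop :=
  (s ^ d < lam → ∀ y ∈ Λ0', ‖ψ y‖ ≤ c * pek * lamk ^ (-(1 / 4 : ℝ))) ∧
    (lam ≤ s ^ d → ∀ y ∈ Λ0', |‖ψ y‖ - (8 * lam) ^ (-(1 / 2 : ℝ)) * s ^ (((d : ℝ) - 2) / 2)| ≤ c * pek * s⁻¹)

/-- **p. 297** [PDF 41], verbatim: *"These bounds allow us to insert the following characteristic functions: χ_{k+1,Λ₀^{(k)′}} =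
Π_{p∈Λ₀^{(k)′**}} χ(ce_kp(e_k), |v(p) − 1|) × Π_{y∈Λ₀^{(k)′}} χ(cp(e_k)λ_k^{−1/4}, |ψ(y)|) Π_{b∈Λ₀^{(k)′*}} χ(cp(e_k), |(D_{ū_{k+1}}ψ)(b)|) and the
integral is unchanged. If (L^kε)^d ≧ λ, the bound on ψ is replaced with χ(cp(e_k)(L^kε)^{−1}, ||ψ(y)| − (8λ)^{−1/2}(L^kε)^{(d−2)/2}|)."* —
with `χ(p, ·)` = `BIJ88Sect5Statements.cutoff`, `X*`, `X**` = `starB`, `starP`, `D_{ū_{k+1}}` = `covD 1 ū`, both regimes.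
[cite: BalabanImbrieJaffe1988, (5.9.3) p.297] -/
def chiNext (χ : CutoffProfile) (c ek pek lamk lam s : ℝ) (d : ℕ) (X : Finset (Balaban1983to89.Site P j)) (v : Plaq P j → ℂ)
    (ψ : Balaban1983to89.Site P j → ℂ) (ubar : PBond P j → ℂ) : ℝ :=
  (∏ p ∈ starP X, cutoff χ (c * ek * pek) ‖v p - 1‖) *
    (∏ y ∈ X, if s ^ d < lam then cutoff χ (c * pek * lamk ^ (-(1 / 4 : ℝ))) ‖ψ y‖
      else cutoff χ (c * pek * s⁻¹) (‖ψ y‖ - (8 * lam) ^ (-(1 / 2 : ℝ)) * s ^ (((d : ℝ) - 2) / 2))) *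
    ∏ b ∈ starB X, cutoff χ (c * pek) ‖covD 1 ubar ψ b‖

/-- **p. 297** [PDF 41], verbatim: *"The bounds (5.9.4), (5.9.5) allow us to insert the characteristic functions χ′_{Λ₇^{(k)}} =
Π_{b∈Λ₇^{(k)*}} χ(cp(e_k), A^{(k)}) Π_{x∈Λ₇^{(k)}} χ(cp(e_k), φ^{(k)}) without changing anything."* — the arguments read as `A^{(k)}_b` (real)
and `|φ^{(k)}(x)|` (the printed bounds (5.9.4)–(5.9.5) are on these). [cite: BalabanImbrieJaffe1988, (5.9.5) p.297] -/
def chiPrime7 (χ : CutoffProfile) (c pek : ℝ) (X : Finset (Balaban1983to89.Site P j)) (A : PBond P j → ℝ)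
    (φk : Balaban1983to89.Site P j → ℂ) : ℝ :=
  (∏ b ∈ starB X, cutoff χ (c * pek) (A b)) * ∏ x ∈ X, cutoff χ (c * pek) ‖φk x‖

/-- kernel: on configurations obeying the bounds STRICTLY inside the plateau (`|A_b| ≤ (9/10)cp(e_k)` on `Λ₇^{(k)*}`, `|φ^{(k)}(x)| ≤
(9/10)cp(e_k)` on `Λ₇^{(k)}`, `cp(e_k) > 0`) the inserted factor `χ′_{Λ₇^{(k)}}` equals `1` — the sense of *"without changing anything"*
for such configurations (`BIJ88Sect5Statements.cutoff_eq_one`). [cite: BalabanImbrieJaffe1988, (5.9.5) p.297] -/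
theorem chiPrime7_eq_one (χ : CutoffProfile) {c pek : ℝ} (hcp : 0 < c * pek) (X : Finset (Balaban1983to89.Site P j))
    {A : PBond P j → ℝ} {φk : Balaban1983to89.Site P j → ℂ} (hA : ∀ b ∈ starB X, |A b| ≤ 9 / 10 * (c * pek))
    (hφ : ∀ x ∈ X, ‖φk x‖ ≤ 9 / 10 * (c * pek)) : chiPrime7 χ c pek X A φk = 1 := by
  unfold chiPrime7
  rw [Finset.prod_eq_one fun b hb => cutoff_eq_one χ hcp (hA b hb),
    Finset.prod_eq_one fun x hx => cutoff_eq_one χ hcp (by rw [abs_norm]; exact hφ x hx), one_mul]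

/-! ## p. 300: the observable and characteristic-function expansions -/

/-- **p. 300** [PDF 44], verbatim: *"We also expand out the observable: Π_σ(F^{m̄}_{k,loc}(X_σ) + F̃_{k,loc}(X_σ) + F̃̃_{k,loc}(X_σ)) = Σ_{σ̃₁}
Π_{σ₁∈σ̃₁} F^{m̄}_{k,loc}(X_{σ₁}) Π_{σ∉σ̃₁} F′_{k,loc}(X_σ), with F′_{k,loc} = F̃_{k,loc} + F̃̃_{k,loc}, and with σ̃₁ summed over subsets of the index set for
σ"* — PROVED (finite product expansion). [cite: BalabanImbrieJaffe1988, (5.11.3) p.300] -/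
theorem obs_expand300 {σ : Type*} [DecidableEq σ] (S : Finset σ) (Fm Ft Ftt : σ → ℝ) :
    ∏ s ∈ S, (Fm s + Ft s + Ftt s) = ∑ T ∈ S.powerset, (∏ s ∈ T, Fm s) * ∏ s ∈ S \ T, (Ft s + Ftt s) := by
  rw [← Finset.prod_add]
  exact Finset.prod_congr rfl fun s _ => by ring

/-- **p. 300** [PDF 44], verbatim: *"and for each type of characteristic function in χ_{Λ₉^{(k)}} we expand χ = 1 − χ^c, as follows:
Π_{x∈Λ₉^{(k)}} χ_x = Σ_{S_x⊂Λ₉^{(k)}} Π_{x∈S_x} (−χ^c_x)."* — PROVED. [cite: BalabanImbrieJaffe1988, (5.11.3) p.300] -/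
theorem chi_expand300 {ι : Type*} [DecidableEq ι] (S : Finset ι) (χc : ι → ℝ) :
    ∏ x ∈ S, (1 - χc x) = ∑ T ∈ S.powerset, ∏ x ∈ T, (-χc x) := by
  have h := Finset.prod_add (fun x => -χc x) (fun _ => (1 : ℝ)) S
  simp only [Finset.prod_const_one, mul_one] at h
  rw [← h]
  exact Finset.prod_congr rfl fun x _ => by ring

/-- **p. 300** [PDF 44], verbatim: *"The characteristic function expansion can now be written as χ_{Λ₉^{(k)}} = Σ_{Λ̃₉^{(k)}} ζ′_{Λ̃₉^{(k)c}},
ζ′_{Λ̃₉^{(k)c}} = Σ_{{S_x,S_y,S_b,S_p} compatible with Λ̃₉^{(k)c}, Λ₉^{(k)}} Π_{x∈S_x}(−χ^c_x) × Π_{y∈S_y}(−χ^c_y) Π_{b∈S_b}(−χ^c_b) Π_{p∈S_p}(−χ^c_p)"* — the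
weight, schematic as in `BIJ88Sect5StatementsPart3.zeta527` (one index set, region map `R`). [cite: BalabanImbrieJaffe1988, (5.11.3) p.300] -/
def zetaPrime300 {ι : Type*} [DecidableEq ι] (S : Finset ι) (χc : ι → ℝ) (R : Finset ι → Finset ι) (Λ₉ : Finset ι) : ℝ :=
  ∑ T ∈ S.powerset.filter (fun T => R T = Λ₉), ∏ x ∈ T, (-χc x)

/-- p. 300, PROVED: `χ_{Λ₉^{(k)}} = Σ_{Λ̃₉^{(k)}} ζ′_{Λ̃₉^{(k)c}}` (fibrewise regrouping of `chi_expand300` over the region map).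
[cite: BalabanImbrieJaffe1988, (5.11.3) p.300] -/
theorem chi_resum300 {ι : Type*} [DecidableEq ι] (S : Finset ι) (χc : ι → ℝ) (R : Finset ι → Finset ι) :
    ∏ x ∈ S, (1 - χc x) = ∑ Λ₉ ∈ S.powerset.image R, zetaPrime300 S χc R Λ₉ := by
  rw [chi_expand300]
  unfold zetaPrime300
  exact (Finset.sum_fiberwise_of_maps_to (fun T hT => Finset.mem_image_of_mem R hT) _).symm

/-! ## p. 300: the regions `Λ̃₈^{(k)}`, `Λ₉^{(k)}`, `Λ̃₉^{(k)}`, `Λ₁₀^{(k)}` -/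

section Regions300

variable {S : Type*} [DecidableEq S]

/-- Deleting a collar neighbourhood of width `r` from a finite region `A` (p. 300: *"by deleting a collar neighborhood of width r(e_k)"*):
keep the points of `A` at distance `≥ r` from every point outside `A` (`dist` the lattice distance, data). [cite: BalabanImbrieJaffe1988, (5.11.3) p.300] -/
def collarDelete [Fintype S] (dist : S → S → ℝ) (r : ℝ) (A : Finset S) : Finset S :=
  A.filter fun x => ∀ y, y ∉ A → r ≤ dist x y

/-- kernel: deleting a collar shrinks the region. [cite: BalabanImbrieJaffe1988, (5.11.3) p.300] -/
theorem collarDelete_subset [Fintype S] (dist : S → S → ℝ) (r : ℝ) (A : Finset S) : collarDelete dist r A ⊆ A :=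
  Finset.filter_subset _ _

/-- **p. 300** [PDF 44], verbatim: *"We now fix σ̃₁, S₄, and define Λ̃₈^{(k)} as follows: Λ̃₈^{(k)} = Λ₈^{(k)} ∖ ⋃_{σ∉σ̃₁} X_σ ∖ ⋃_{(j,x_j,X)∈S₄} X."* —
`σout` = the indices `σ ∉ σ̃₁`, `Xσ` their localization sets, `XS4` = the polymers `X` occurring in `S₄`. [cite: BalabanImbrieJaffe1988, (5.11.3) p.300] -/
def lamTilde8 {σ : Type*} (Λ8 : Finset S) (σout : Finset σ) (Xσ : σ → Finset S) (XS4 : Finset (Finset S)) : Finset S :=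
  (Λ8 \ σout.biUnion Xσ) \ XS4.biUnion id

/-- **p. 300**, verbatim: *"Then we define Λ₉^{(k)} by deleting a collar neighborhood of width r(e_k) from Λ̃₈^{(k)}."*
[cite: BalabanImbrieJaffe1988, (5.11.3) p.300] -/
def lam9 [Fintype S] {σ : Type*} (dist : S → S → ℝ) (rek : ℝ) (Λ8 : Finset S) (σout : Finset σ) (Xσ : σ → Finset S)
    (XS4 : Finset (Finset S)) : Finset S :=
  collarDelete dist rek (lamTilde8 Λ8 σout Xσ XS4)

/-- kernel: `Λ₉^{(k)} ⊆ Λ̃₈^{(k)} ⊆ Λ₈^{(k)}`. [cite: BalabanImbrieJaffe1988, (5.11.3) p.300] -/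
theorem lam9_subset [Fintype S] {σ : Type*} (dist : S → S → ℝ) (rek : ℝ) (Λ8 : Finset S) (σout : Finset σ) (Xσ : σ → Finset S)
    (XS4 : Finset (Finset S)) :
    lam9 dist rek Λ8 σout Xσ XS4 ⊆ lamTilde8 Λ8 σout Xσ XS4 ∧ lamTilde8 Λ8 σout Xσ XS4 ⊆ Λ8 :=
  ⟨collarDelete_subset _ _ _, (Finset.sdiff_subset).trans Finset.sdiff_subset⟩

end Regions300

/-- **p. 300** [PDF 44], verbatim: *"We have similar sums over S_y ⊂ Λ₉^{(k)′}, S_b ⊂ Λ₉^{(k)*}, S_p ⊂ Λ₉^{(k)**}, and we define Λ̃₉^{(k)} as the union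
of all r(e_k)-cubes in Λ₉^{(k)}, none of whose points are in S_x, or in bonds, plaquettes, or blocks in S_b, S_p, S_y."* — this IS the
construction of `Λ₀^{(k)}` on p. 279 with `Λ₁₃^{(k−1)′} ↦ Λ₉^{(k)}`, `P ↦ S`: `BIJ88Sect5StatementsPart3.smallFieldRegion`.
[cite: BalabanImbrieJaffe1988, (5.11.3) p.300] -/
def lamTilde9 {γ : Type*} (cube : Balaban1983to89.Site P j → γ) (Λ9 Sx : Finset (Balaban1983to89.Site P j))
    (Sy : Finset (Balaban1983to89.Site P (j + 1))) (Sb : Finset (PBond P j)) (Sp : Finset (Plaq P j)) :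
    Finset (Balaban1983to89.Site P j) :=
  smallFieldRegion cube Λ9 Sx Sy Sb Sp

/-- **p. 300**, verbatim: *"Finally we define Λ₁₀^{(k)} by deleting a collar neighborhood from Λ̃₉^{(k)}."* (width as for `Λ₉^{(k)}`, data `rek`).
[cite: BalabanImbrieJaffe1988, (5.11.3) p.300] -/
def lam10 {γ : Type*} (dist : Balaban1983to89.Site P j → Balaban1983to89.Site P j → ℝ) (rek : ℝ)
    (cube : Balaban1983to89.Site P j → γ) (Λ9 Sx : Finset (Balaban1983to89.Site P j)) (Sy : Finset (Balaban1983to89.Site P (j + 1)))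
    (Sb : Finset (PBond P j)) (Sp : Finset (Plaq P j)) : Finset (Balaban1983to89.Site P j) :=
  collarDelete dist rek (lamTilde9 cube Λ9 Sx Sy Sb Sp)

/-- kernel: the nesting `Λ₁₀^{(k)} ⊆ Λ̃₉^{(k)} ⊆ Λ₉^{(k)}` (cf. p. 274 *"We have Λ_α^{(j)} ⊂ Λ_{α−1}^{(j)}"*, `BIJ88Sect4Statements.RegionTower`).
[cite: BalabanImbrieJaffe1988, (5.11.3) p.300] -/
theorem lam10_subset {γ : Type*} (dist : Balaban1983to89.Site P j → Balaban1983to89.Site P j → ℝ) (rek : ℝ)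
    (cube : Balaban1983to89.Site P j → γ) (Λ9 Sx : Finset (Balaban1983to89.Site P j)) (Sy : Finset (Balaban1983to89.Site P (j + 1)))
    (Sb : Finset (PBond P j)) (Sp : Finset (Plaq P j)) :
    lam10 dist rek cube Λ9 Sx Sy Sb Sp ⊆ lamTilde9 cube Λ9 Sx Sy Sb Sp ∧ lamTilde9 cube Λ9 Sx Sy Sb Sp ⊆ Λ9 :=
  ⟨collarDelete_subset _ _ _, smallFieldRegion_subset _ _ _ _ _ _⟩

/-- **p. 312** [PDF 56] (Sect. 5.14), verbatim (row C2.Claim@312): *"we have finally an estimate |G_k(X)| ≦ c(F(X))(e^β(L^kε/ε₀)^{1/4−α})^{β′|X∖∪X_c|}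
Π_{X_{σ₁}⊂X: dist(X_{σ₁},Λ₁₂^{(k)c}) < r(e_k)} [c(L^kε)^{−m(c)}e^{−m′(c)}]"* — schematic leaf over `BIJ88Sect5StatementsPart2.PolymerSys` (F6): `cF X` =
c(F(X)), `nfree X` = |X∖∪X_c| (cube count), `obsProd X` = the printed product over the observable localizations near `Λ₁₂^{(k)c}`,
`θ` = the vertex factor. [cite: BalabanImbrieJaffe1988, (5.14.5) p.312] -/
def Ineq312 (Q : BIJ88Sect5StatementsPart2.PolymerSys) (Gk cF obsProd : Q.Poly → ℝ) (nfree : Q.Poly → ℕ) (θ β' : ℝ) : Prop :=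
  ∀ X, |Gk X| ≤ cF X * θ ^ (β' * nfree X) * obsProd X

/-! ## p. 300 (Sect. 5.12): the completing-the-square identity behind the conditioning formula -/

section CompleteSquare

open Matrix

/-- kernel (plumbing): a symmetric matrix moves across the dot product. [folklore] -/
private theorem symm_dotProduct {Λ : Type*} [Fintype Λ] {G : Matrix Λ Λ ℝ} (hG : G.IsSymm) (b y : Λ → ℝ) :
    (G *ᵥ b) ⬝ᵥ y = b ⬝ᵥ (G *ᵥ y) := by
  rw [dotProduct_comm, Matrix.dotProduct_mulVec, ← Matrix.mulVec_transpose, hG.eq, dotProduct_comm]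

/-- **p. 300** [PDF 44] (Sect. 5.12 *Conditional Integration*), verbatim: *"The formula we use is a generalization of the following
identity for scalar fields: ∫dφ|_{Λ^c}F(φ|_{Λ^c})∫dφ|_Λ e^{−⟨Λ^cφ,ΔΛφ⟩}e^{−1/2⟨φ,Δ_Λφ⟩}G(φ) = … = (∫dφ|_Λ e^{−1/2⟨φ,Δ_Λφ⟩})∫dφ|_{Λ^c}F(φ|_{Λ^c})
e^{1/2⟨Λ^cφ,ΔΔ_Λ^{−1}ΔΛ^cφ⟩} × (1/𝒩)∫dφ|_ΛG(φ)e^{−1/2⟨φ,Δ_Λφ⟩}e^{−⟨Λ^cφ,ΔΛφ⟩}."* — the ALGEBRAIC CORE, PROVED for matrices: with `Δ` =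
`Δ_Λ` symmetric, `G = Δ_Λ^{−1}` symmetric (two-sided inverse), `B` the coupling block (`⟨Λ^cφ, ΔΛφ⟩ = ⟨φ_Λ, Bφ_{Λ^c}⟩`), the exponent
completes to a square under the translation `φ_Λ ↦ φ_Λ + GBφ_{Λ^c}`:
`⟨φ_Λ, Bφ_c⟩ + ½⟨φ_Λ, Δφ_Λ⟩ = ½⟨φ_Λ + GBφ_c, Δ(φ_Λ + GBφ_c)⟩ − ½⟨Bφ_c, GBφ_c⟩` — whence the factor `e^{½⟨Λ^cφ, ΔΔ_Λ^{−1}ΔΛ^cφ⟩}` by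
translation invariance of `dφ|_Λ`.  The Gaussian integrals themselves and (5.12.1)–(5.12.8) are not typed.
[cite: BalabanImbrieJaffe1988, (5.12.1) p.300] -/
theorem completeSquare300 {Λ Λc : Type*} [Fintype Λ] [DecidableEq Λ] [Fintype Λc] (Δ G : Matrix Λ Λ ℝ) (B : Matrix Λ Λc ℝ)
    (hG : G.IsSymm) (hGΔ : G * Δ = 1) (hΔG : Δ * G = 1) (φ : Λ → ℝ) (φc : Λc → ℝ) :
    φ ⬝ᵥ (B *ᵥ φc) + (1 / 2) * (φ ⬝ᵥ (Δ *ᵥ φ))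
      = (1 / 2) * ((φ + G *ᵥ (B *ᵥ φc)) ⬝ᵥ (Δ *ᵥ (φ + G *ᵥ (B *ᵥ φc))))
        - (1 / 2) * ((B *ᵥ φc) ⬝ᵥ (G *ᵥ (B *ᵥ φc))) := by
  have h1 : Δ *ᵥ (G *ᵥ (B *ᵥ φc)) = B *ᵥ φc := by rw [Matrix.mulVec_mulVec, hΔG, Matrix.one_mulVec]
  have h2 : G *ᵥ (Δ *ᵥ φ) = φ := by rw [Matrix.mulVec_mulVec, hGΔ, Matrix.one_mulVec]
  rw [Matrix.mulVec_add, h1, add_dotProduct, dotProduct_add, dotProduct_add, symm_dotProduct hG (B *ᵥ φc) (Δ *ᵥ φ), h2,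
    symm_dotProduct hG (B *ᵥ φc) (B *ᵥ φc), dotProduct_comm (B *ᵥ φc) φ]
  ring

end CompleteSquare

/-! ## (5.13.2): the new quadratic form for the exterior gauge field -/

/-- **(5.13.2)** p. 304 [PDF 48], verbatim: *"Thus we have a new quadratic form for Λ₁₀^{(k)c*c}A^{(k)″}, namely Q*Q + (I − Q*Q^s)∂*σ_{k,loc}∂
(I − Q^{s*}Q). (5.13.2)"* — in a ring of operators (`Qst` = Q*, `Qsst` = Q^{s*}; the lower bound asserted next is
`BIJ88Sect5Statements.claim304_lower`). [cite: BalabanImbrieJaffe1988, (5.13.2) p.304] -/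
def form5132 {R : Type*} [Ring R] (Q Qst Qs Qsst ds σloc d : R) : R :=
  Qst * Q + (1 - Qst * Qs) * ds * σloc * d * (1 - Qsst * Q)

/-! ## (5.14.2): the perturbative terms and the remainder; Taylor's formula -/

/-- **(5.14.2)** p. 308 [PDF 52], verbatim: *"Thus we define perturbative terms for the action, 𝒫̃_{k+1}(Λ₁₂^{(k)}) = Σ_{α=1}^{n̄} −(1/α!)
(d^α/dt^α) log z_t(Λ₁₂^{(k)})|_{t=0},"* — for a real function `logz : t ↦ log z_t(Λ₁₂^{(k)})` on `[0,1]`, derivatives within `[0,1]`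
(index written `α + 1`, `α < n̄`).
[cite: BalabanImbrieJaffe1988, (5.14.2) p.308] -/
def pertP (logz : ℝ → ℝ) (nbar : ℕ) : ℝ :=
  ∑ α ∈ Finset.range nbar, -((1 : ℝ) / (α + 1).factorial) * iteratedDerivWithin (α + 1) logz (Set.uIcc 0 1) 0

/-- **(5.14.2)**, the remainder, verbatim: *"and a remainder ℛ_k(Λ₁₂^{(k)}) = ∫₀¹ dt −((1−t)^{n̄}/(n̄+1)!) ⟨d/dt; …; d/dt⟩_t. (5.14.2) Here ⟨·⟩_t
is the interacting expectation …"* — the truncated expectation of `n̄+1` factors `d/dt` carried as a function `trunc : t ↦ ⟨d/dt;…;d/dt⟩_t`.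
TRANSCRIPTION NOTE (recorded, not adjudicated): with the standard identification `⟨d/dt;…;d/dt⟩_t` (`n̄+1` entries) `= d^{n̄+1}/dt^{n̄+1} log z_t`,
Taylor's formula (`taylor_logz`) has the weight `(1−t)^{n̄}/n̄!`; the printed `(n̄+1)!` presumes a truncated expectation larger by the factor
`n̄+1` (`remR_eq_taylor`). [cite: BalabanImbrieJaffe1988, (5.14.2) p.308] -/
def remR (trunc : ℝ → ℝ) (nbar : ℕ) : ℝ :=
  ∫ t in (0 : ℝ)..1, -((1 - t) ^ nbar / (nbar + 1).factorial) * trunc t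

/-- kernel: Taylor's formula with integral remainder for `t ↦ log z_t` on `[0, 1]` (Mathlib `taylor_integral_remainder`):
`log z₁ = log z₀ − 𝒫̃_{k+1} + ∫₀¹ ((1−t)^{n̄}/n̄!) (d^{n̄+1}/dt^{n̄+1}) log z_t dt` for `log z_t` of class `C^{n̄+1}` on `[0,1]` — the sense of
*"z_F = (z_F/z) exp(log z)"* with the expansion of `log z` into `𝒫̃` plus remainder (p. 308). [cite: BalabanImbrieJaffe1988, (5.14.2) p.308] -/
theorem taylor_logz {logz : ℝ → ℝ} {nbar : ℕ} (h : ContDiffOn ℝ (nbar + 1 : ℕ) logz (Set.uIcc 0 1)) :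
    logz 1 = logz 0 - pertP logz nbar
      + ∫ t in (0 : ℝ)..1, ((1 - t) ^ nbar / nbar.factorial) * iteratedDerivWithin (nbar + 1) logz (Set.uIcc 0 1) t := by
  have ht := taylor_integral_remainder (x := 1) (x₀ := 0) h
  simp only [smul_eq_mul] at ht
  have hP : taylorWithinEval logz nbar (Set.uIcc 0 1) 0 1 = logz 0 - pertP logz nbar := by
    rw [taylor_within_apply, Finset.sum_range_succ', pertP]
    simp only [sub_zero, one_pow, mul_one, Nat.factorial_zero, Nat.cast_one, inv_one, iteratedDerivWithin_zero, smul_eq_mul,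
      one_mul]
    have hs : ∑ α ∈ Finset.range nbar, -((1 : ℝ) / (α + 1).factorial) * iteratedDerivWithin (α + 1) logz (Set.uIcc 0 1) 0
        = -∑ α ∈ Finset.range nbar, ((α + 1).factorial : ℝ)⁻¹ * iteratedDerivWithin (α + 1) logz (Set.uIcc 0 1) 0 := by
      rw [← Finset.sum_neg_distrib]
      exact Finset.sum_congr rfl fun α _ => by ring
    rw [hs]
    ring
  linarith [ht, hP]

/-- kernel: the printed remainder (5.14.2) equals the Taylor remainder of `taylor_logz` exactly when the truncated expectation is
`(n̄+1)·(d^{n̄+1}/dt^{n̄+1}) log z_t` (then `ℛ_k = −∫₀¹ ((1−t)^{n̄}/n̄!) d^{n̄+1} log z_t dt` and `log z₁ = log z₀ − 𝒫̃_{k+1} − ℛ_k`).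
[cite: BalabanImbrieJaffe1988, (5.14.2) p.308] -/
theorem remR_eq_taylor {logz trunc : ℝ → ℝ} {nbar : ℕ}
    (htr : ∀ t, trunc t = ((nbar : ℝ) + 1) * iteratedDerivWithin (nbar + 1) logz (Set.uIcc 0 1) t) :
    remR trunc nbar = -∫ t in (0 : ℝ)..1, ((1 - t) ^ nbar / nbar.factorial) * iteratedDerivWithin (nbar + 1) logz (Set.uIcc 0 1) t := by
  rw [remR, ← intervalIntegral.integral_neg]
  congr 1
  funext t
  rw [htr t, Nat.factorial_succ]
  push_cast
  have hf : ((nbar.factorial : ℕ) : ℝ) ≠ 0 := by exact_mod_cast Nat.factorial_ne_zero nbar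
  have hn : ((nbar : ℝ) + 1) ≠ 0 := Nat.cast_add_one_ne_zero nbar
  field_simp

/-- kernel: under that identification, `log z₁ = log z₀ − 𝒫̃_{k+1} − ℛ_k`. [cite: BalabanImbrieJaffe1988, (5.14.2) p.308] -/
theorem logz_split {logz trunc : ℝ → ℝ} {nbar : ℕ} (h : ContDiffOn ℝ (nbar + 1 : ℕ) logz (Set.uIcc 0 1))
    (htr : ∀ t, trunc t = ((nbar : ℝ) + 1) * iteratedDerivWithin (nbar + 1) logz (Set.uIcc 0 1) t) :
    logz 1 = logz 0 - pertP logz nbar - remR trunc nbar := by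
  rw [remR_eq_taylor htr, taylor_logz h]
  ring

end

end Literature.MathematicalPhysics.QuantumFieldTheory.BalabanImbrieJaffe1984to88.BIJ88Sect5StatementsPart4
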